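import Mathlib.GroupTheory.Index
import Mathlib.GroupTheory.QuotientGroup.Basic
import Mathlib.GroupTheory.Subgroup.Centralizer
import Mathlib.Algebra.Group.Subgroup.Pointwise
import Mathlib.Algebra.Group.Pointwise.Set.Card
import Mathlib.Algebra.Order.BigOperators.Group.Finset
import Mathlib.Algebra.BigOperators.Ring.Finset
import Mathlib.Algebra.Group.Subgroup.Finite
import Mathlib.Algebra.Order.Field.Basic
import Mathlib.Data.Real.Basic
import Mathlib.Tactic.FieldSimp
import Mathlib.Tactic.Linarith
import Mathlib.Tactic.Group
import Mathlib.Tactic.Ring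
import HarnessLib

/-!
# Elements with central square: conjugation orbits of the cosets `gZ`, and a contraction lemma

Topic `Literature/GroupTheory`; namespace `Literature.GroupTheory.SquareCentral`.  Pure finite group
theory (Mathlib only); everything is PROVED, nothing is defined, no named facts.

Fix a group `G` and a **central** subgroup `Z ≤ Z(G)`, and consider the conjugation-stable set
`T = {x ∈ G : x² ∈ Z}` (for `G ≤ GL₂` and `Z` the scalars: the elements which are involutions in
`PGL₂`, e.g. the Frobenius elements of the supersingular primes of an elliptic curve, whose
characteristic polynomial is `X² + p`).  This file supplies the two group-theoretic inputs of the
`ℓ`-adic proof that the supersingular primes of a non-CM elliptic curve have density zero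
(`Literature/NumberTheory/EllipticCurves/SupersingularDensity*`, Serre 1968, IV-13, Exercise):

* **Orbit decomposition and the fixed-point datum** (for the natural-density upper bound of
  `Literature.NumberTheory.LFunctions.Chebotarev.eventually_card_primesLE_filter_frobPrimes_le`,
  which needs, for a conjugation-stable `C` and a subgroup `H`, a uniform lower bound
  `k · #H ≤ #{y : y⁻¹ x y ∈ H}` over `x ∈ C` and then bounds the upper density of the Frobenius
  set of `C` by `1/k`).  `T ∖ Z` is the disjoint union of the orbits
  `O_g = {y g z y⁻¹ : y ∈ G, z ∈ Z}` (`exists_finset_orbits_sq_mem`); for `g ∈ T` the subgroup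
  `H_g = ⟨g⟩ Z = Z ∪ g Z` has order `≤ 2 #Z` (`natCard_zpowers_sup_le`) and is contained in the
  stabiliser `S_g = Stab(gZ)` of the coset `g Z` under conjugation (Mathlib's
  `Subgroup.normalizer (g • Z)`); every `x ∈ O_g` has at least `#S_g` conjugators into `H_g`
  (`natCard_setNormalizer_le_natCard_conj_mem`), and `#G · #Z ≤ #O_g · #S_g`
  (`natCard_mul_natCard_le_natCard_orbit_mul`), whence with `k_g = [S_g : H_g]` the bound
  **`1/k_g ≤ 2 #O_g / #G`** (`one_div_le_two_mul_natCard_orbit_div`): the density bound of each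
  orbit is at most twice its share, and summing over the decomposition bounds the upper density of
  the Frobenius set of `T` by `2 #T / #G`.
* **Contraction lemma** (`four_mul_natCard_sq_mem_le`): if `K ⊴ G` contains two elements whose
  commutator is not in `Z`, then every coset `g₀ K` meets `T` in at most `¾ #K` elements; hence
  along a surjection `π : G ↠ Q` with kernel `K` and compatible central subgroups,
  `#T_G/#G ≤ ¾ · #T_Q/#Q` (`natCard_sq_mem_div_le_of_commutator_not_mem`).  Mechanism
  (`commutator_mem_of_sq_mul_mem`): for `g² ∈ Z`, `(gu)² ∈ Z ⟺ (g⁻¹ug)u ∈ Z`, and if `u, v, uv` all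
  have this property then `u⁻¹v⁻¹uv ∈ Z`; a subset of `K` of density `> ¾` closed in this sense
  forces `K/(K ∩ Z)`-commutativity by two applications of "a subgroup containing more than half of
  a finite group is the whole group" (the argument behind the `5/8`-bound for the commuting
  probability of a non-abelian finite group, W. H. Gustafson, Amer. Math. Monthly 80 (1973)).

## Design

Theorems only; the orbit `O_g` is written as the predicate `∃ y, ∃ z ∈ Z, x = y * (g * z) * y⁻¹`
throughout (no definition is introduced), the stabiliser as `Subgroup.normalizer (g • (Z : Set G))`
and `H_g` as `Subgroup.zpowers g ⊔ Z`; cardinalities are `Nat.card`, ratios are real numbers.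
-/

open scoped Pointwise

namespace Literature.GroupTheory.SquareCentral

variable {G : Type*} [Group G] {Z : Subgroup G}

/-- Central elements commute with everything. [folklore] -/
theorem mul_eq_mul_of_le_center (hZ : Z ≤ Subgroup.center G) {z : G} (hz : z ∈ Z) (g : G) :
    g * z = z * g :=
  Subgroup.mem_center_iff.mp (hZ hz) g

/-- Conjugates of central elements. [folklore] -/
theorem conj_eq_of_le_center (hZ : Z ≤ Subgroup.center G) {z : G} (hz : z ∈ Z) (y : G) :
    y * z * y⁻¹ = z := by
  rw [mul_eq_mul_of_le_center hZ hz y, mul_inv_cancel_right]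

/-- A central subgroup is normal. [folklore] -/
theorem normal_of_le_center (hZ : Z ≤ Subgroup.center G) : Z.Normal :=
  ⟨fun z hz y ↦ by rwa [conj_eq_of_le_center hZ hz y]⟩

/-- From `w g w⁻¹ = g z₀` with `z₀` central: `w⁻¹ g w = g z₀⁻¹`. [folklore] -/
theorem inv_conj_eq_of_conj_eq (hZ : Z ≤ Subgroup.center G) {g w z₀ : G} (hz₀ : z₀ ∈ Z)
    (hw : w * g * w⁻¹ = g * z₀) : w⁻¹ * g * w = g * z₀⁻¹ := by
  have h2 : w⁻¹ * g * w * z₀ = g := by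
    calc w⁻¹ * g * w * z₀ = w⁻¹ * g * (w * z₀) := by group
      _ = w⁻¹ * g * (z₀ * w) := by rw [mul_eq_mul_of_le_center hZ hz₀ w]
      _ = w⁻¹ * (g * z₀) * w := by group
      _ = w⁻¹ * (w * g * w⁻¹) * w := by rw [hw]
      _ = g := by group
  exact eq_mul_inv_of_mul_eq h2

/-- If `w g w⁻¹ ∈ g Z` then `w` stabilises the coset `g Z` under conjugation
(`Subgroup.normalizer`). [folklore] -/
theorem mem_setNormalizer_smul_of_conj_eq (hZ : Z ≤ Subgroup.center G) {g w z₀ : G}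
    (hz₀ : z₀ ∈ Z) (hw : w * g * w⁻¹ = g * z₀) :
    w ∈ Subgroup.normalizer (g • (Z : Set G)) := by
  intro n
  rw [mem_leftCoset_iff, mem_leftCoset_iff]
  constructor
  · intro hn
    have key : w * n * w⁻¹ = g * (z₀ * (g⁻¹ * n)) := by
      calc w * n * w⁻¹ = w * g * ((g⁻¹ * n) * w⁻¹) := by group
        _ = w * g * (w⁻¹ * (g⁻¹ * n)) := by rw [mul_eq_mul_of_le_center hZ hn w⁻¹]
        _ = w * g * w⁻¹ * (g⁻¹ * n) := by group
        _ = g * (z₀ * (g⁻¹ * n)) := by rw [hw, mul_assoc]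
    rw [key, inv_mul_cancel_left]
    exact Z.mul_mem hz₀ hn
  · intro hn
    have hw' := inv_conj_eq_of_conj_eq hZ hz₀ hw
    have key : n = g * (z₀⁻¹ * (g⁻¹ * (w * n * w⁻¹))) := by
      calc n = w⁻¹ * g * ((g⁻¹ * (w * n * w⁻¹)) * w) := by group
        _ = w⁻¹ * g * (w * (g⁻¹ * (w * n * w⁻¹))) := by
            rw [mul_eq_mul_of_le_center hZ hn w]
        _ = w⁻¹ * g * w * (g⁻¹ * (w * n * w⁻¹)) := by group
        _ = g * (z₀⁻¹ * (g⁻¹ * (w * n * w⁻¹))) := by rw [hw', mul_assoc]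
    rw [key, inv_mul_cancel_left]
    exact Z.mul_mem (Z.inv_mem hz₀) hn

/-- A stabiliser `w` of `g Z` conjugates `g` into `g Z`. [folklore] -/
theorem exists_conj_eq_of_mem_setNormalizer {g w : G}
    (hw : w ∈ Subgroup.normalizer (g • (Z : Set G))) : ∃ z ∈ Z, w * g * w⁻¹ = g * z := by
  have h : g ∈ g • (Z : Set G) := mem_leftCoset_iff (a := g) |>.mpr (by rw [inv_mul_cancel]; exact Z.one_mem)
  have h2 := (hw g).mp h
  rw [mem_leftCoset_iff] at h2
  exact ⟨_, h2, by rw [mul_inv_cancel_left]⟩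

/-- `Z` stabilises `g Z`. [folklore] -/
theorem le_setNormalizer_smul (hZ : Z ≤ Subgroup.center G) (g : G) :
    Z ≤ Subgroup.normalizer (g • (Z : Set G)) := fun z hz ↦ by
  -- `z g z⁻¹ = g`
  have h : z * g * z⁻¹ = g * 1 := by
    rw [mul_one, ← mul_eq_mul_of_le_center hZ hz g, mul_inv_cancel_right]
  exact mem_setNormalizer_smul_of_conj_eq hZ Z.one_mem h

/-- `g` stabilises `g Z`. [folklore] -/
theorem mem_setNormalizer_smul_self (hZ : Z ≤ Subgroup.center G) (g : G) :
    g ∈ Subgroup.normalizer (g • (Z : Set G)) :=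
  mem_setNormalizer_smul_of_conj_eq hZ Z.one_mem (by rw [mul_inv_cancel_right, mul_one])

/-- `⟨g⟩ Z` stabilises `g Z`. [folklore] -/
theorem zpowers_sup_le_setNormalizer_smul (hZ : Z ≤ Subgroup.center G) (g : G) :
    Subgroup.zpowers g ⊔ Z ≤ Subgroup.normalizer (g • (Z : Set G)) :=
  sup_le ((Subgroup.zpowers_le).mpr (mem_setNormalizer_smul_self hZ g)) (le_setNormalizer_smul hZ g)

/-- For `g² ∈ Z` (central): `⟨g⟩ Z ⊆ Z ∪ g Z`. [folklore] -/
theorem coe_zpowers_sup_subset (hZ : Z ≤ Subgroup.center G) {g : G} (hg : g ^ 2 ∈ Z) :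
    ((Subgroup.zpowers g ⊔ Z : Subgroup G) : Set G) ⊆ (Z : Set G) ∪ g • (Z : Set G) := by
  haveI := normal_of_le_center hZ
  rw [Subgroup.mul_normal]
  rintro x ⟨a, ha, z, hz, rfl⟩
  obtain ⟨k, rfl⟩ := Subgroup.mem_zpowers_iff.mp ha
  have hg2 : g ^ (2 : ℤ) ∈ Z := by exact_mod_cast hg
  rcases Int.even_or_odd' k with ⟨j, rfl | rfl⟩
  · left
    have : g ^ (2 * j) = (g ^ (2 : ℤ)) ^ j := zpow_mul g 2 j
    rw [this]
    exact Z.mul_mem (Z.zpow_mem hg2 j) hz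
  · right
    rw [mem_leftCoset_iff]
    have : g⁻¹ * (g ^ (2 * j + 1) * z) = (g ^ (2 : ℤ)) ^ j * z := by
      rw [zpow_add, zpow_one, zpow_mul]
      group
    rw [this]
    exact Z.mul_mem (Z.zpow_mem hg2 j) hz

/-- For `g² ∈ Z` (central): `#⟨g⟩Z ≤ 2 · #Z`. [folklore] -/
theorem natCard_zpowers_sup_le [Finite G] (hZ : Z ≤ Subgroup.center G) {g : G} (hg : g ^ 2 ∈ Z) :
    Nat.card (Subgroup.zpowers g ⊔ Z : Subgroup G) ≤ 2 * Nat.card Z := by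
  rw [← SetLike.coe_sort_coe, Nat.card_coe_set_eq]
  calc ((Subgroup.zpowers g ⊔ Z : Subgroup G) : Set G).ncard
      ≤ ((Z : Set G) ∪ g • (Z : Set G)).ncard :=
        Set.ncard_le_ncard (coe_zpowers_sup_subset hZ hg) (Set.toFinite _)
    _ ≤ (Z : Set G).ncard + (g • (Z : Set G)).ncard := Set.ncard_union_le _ _
    _ = 2 * Nat.card Z := by
        rw [Set.ncard_smul_set, ← Nat.card_coe_set_eq, SetLike.coe_sort_coe, two_mul]

/-! #### The conjugation orbit of the coset `g Z` -/

/-- Every element of the orbit `{y g z y⁻¹}` of the coset `g Z` has at least `#Stab(gZ)`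
conjugators into `⟨g⟩ Z`. [folklore] -/
theorem natCard_setNormalizer_le_natCard_conj_mem (hZ : Z ≤ Subgroup.center G) [Finite G]
    {g x : G} (hx : ∃ y : G, ∃ z ∈ Z, x = y * (g * z) * y⁻¹) :
    Nat.card (Subgroup.normalizer (g • (Z : Set G))) ≤
      Nat.card {y : G // y⁻¹ * x * y ∈ Subgroup.zpowers g ⊔ Z} := by
  obtain ⟨y₀, z₀, hz₀, rfl⟩ := hx
  refine Nat.card_le_card_of_injective
    (fun w ↦ ⟨y₀ * w, ?_⟩) (fun w w' h ↦ Subtype.ext (mul_left_cancel (congrArg Subtype.val h)))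
  obtain ⟨z, hz, hwz⟩ := exists_conj_eq_of_mem_setNormalizer (Subgroup.inv_mem _ w.2)
  rw [inv_inv] at hwz
  have : (y₀ * w)⁻¹ * (y₀ * (g * z₀) * y₀⁻¹) * (y₀ * w) = g * (z * z₀) := by
    calc (y₀ * ↑w)⁻¹ * (y₀ * (g * z₀) * y₀⁻¹) * (y₀ * ↑w)
        = (↑w)⁻¹ * g * ↑w * ((↑w)⁻¹ * z₀ * ↑w) := by group
      _ = g * (z * z₀) := by
          rw [hwz, mul_eq_mul_of_le_center hZ hz₀ (↑w)⁻¹, inv_mul_cancel_right, mul_assoc]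
  rw [this]
  exact Subgroup.mul_mem _ (Subgroup.mem_sup_left (Subgroup.mem_zpowers g))
    (Subgroup.mem_sup_right (Z.mul_mem hz hz₀))

/-- Orbit–stabiliser count for the coset `g Z` under conjugation:
`#G · #Z ≤ #{y g z y⁻¹} · #Stab(gZ)`. [folklore] -/
theorem natCard_mul_natCard_le_natCard_orbit_mul (hZ : Z ≤ Subgroup.center G) [Finite G] (g : G) :
    Nat.card G * Nat.card Z ≤
      Nat.card {x : G // ∃ y : G, ∃ z ∈ Z, x = y * (g * z) * y⁻¹} *
        Nat.card (Subgroup.normalizer (g • (Z : Set G))) := by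
  -- base points
  have hb : ∀ x : {x : G // ∃ y : G, ∃ z ∈ Z, x = y * (g * z) * y⁻¹},
      ∃ y : G, ∃ z ∈ Z, (x : G) = y * (g * z) * y⁻¹ := fun x ↦ x.2
  choose b c hc hbc using hb
  rw [← Nat.card_prod, ← Nat.card_prod]
  refine Nat.card_le_card_of_injective
    (fun yz : G × Z ↦ (⟨⟨yz.1 * (g * yz.2) * yz.1⁻¹, yz.1, yz.2, yz.2.2, rfl⟩,
      ⟨(b ⟨yz.1 * (g * yz.2) * yz.1⁻¹, yz.1, yz.2, yz.2.2, rfl⟩)⁻¹ * yz.1, ?_⟩⟩)) ?_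
  · -- the second component stabilises `g Z`
    set x : {x : G // ∃ y : G, ∃ z ∈ Z, x = y * (g * z) * y⁻¹} :=
      ⟨yz.1 * (g * yz.2) * yz.1⁻¹, yz.1, yz.2, yz.2.2, rfl⟩ with hxdef
    have hx : yz.1 * (g * yz.2) * yz.1⁻¹ = b x * (g * c x) * (b x)⁻¹ := hbc x
    refine mem_setNormalizer_smul_of_conj_eq hZ (Z.mul_mem (hc x) (Z.inv_mem yz.2.2)) ?_
    -- `(b⁻¹ y) g (b⁻¹ y)⁻¹ = g (c x) z⁻¹`
    have h1 : (b x)⁻¹ * yz.1 * (g * ↑yz.2) * ((b x)⁻¹ * yz.1)⁻¹ = g * c x := by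
      calc (b x)⁻¹ * yz.1 * (g * ↑yz.2) * ((b x)⁻¹ * yz.1)⁻¹
          = (b x)⁻¹ * (yz.1 * (g * ↑yz.2) * yz.1⁻¹) * b x := by group
        _ = (b x)⁻¹ * (b x * (g * c x) * (b x)⁻¹) * b x := by rw [hx]
        _ = g * c x := by group
    calc (b x)⁻¹ * yz.1 * g * ((b x)⁻¹ * yz.1)⁻¹
        = (b x)⁻¹ * yz.1 * (g * ↑yz.2) * ((b x)⁻¹ * yz.1)⁻¹ *
            (((b x)⁻¹ * yz.1) * (↑yz.2)⁻¹ * ((b x)⁻¹ * yz.1)⁻¹) := by group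
      _ = g * c x * (↑yz.2)⁻¹ := by
          rw [h1, conj_eq_of_le_center hZ (Z.inv_mem yz.2.2)]
      _ = g * (c x * (↑yz.2)⁻¹) := mul_assoc _ _ _
  · rintro ⟨y, z⟩ ⟨y', z'⟩ h
    simp only [Prod.mk.injEq, Subtype.mk.injEq] at h
    obtain ⟨hx, hw⟩ := h
    have hy : y = y' := by
      have hxx : (⟨y * (g * z) * y⁻¹, y, z, z.2, rfl⟩ :
          {x : G // ∃ y : G, ∃ z ∈ Z, x = y * (g * z) * y⁻¹}) =
          ⟨y' * (g * z') * y'⁻¹, y', z', z'.2, rfl⟩ := Subtype.ext hx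
      rw [hxx] at hw
      exact mul_left_cancel hw
    subst hy
    have hz : (z : G) = z' := mul_left_cancel (mul_left_cancel (mul_right_cancel hx))
    exact Prod.ext rfl (Subtype.ext hz)

/-! #### The fixed-point datum of the orbit of `g Z` -/

/-- `k_g · #⟨g⟩Z = #Stab(gZ)` for `k_g = #Stab(gZ) / #⟨g⟩Z`. [folklore] -/
theorem div_mul_natCard_zpowers_sup (hZ : Z ≤ Subgroup.center G) [Finite G] (g : G) :
    Nat.card (Subgroup.normalizer (g • (Z : Set G))) /
        Nat.card (Subgroup.zpowers g ⊔ Z : Subgroup G) *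
      Nat.card (Subgroup.zpowers g ⊔ Z : Subgroup G) =
      Nat.card (Subgroup.normalizer (g • (Z : Set G))) :=
  Nat.div_mul_cancel (Subgroup.card_dvd_of_le (zpowers_sup_le_setNormalizer_smul hZ g))

/-- `k_g ≥ 1`. [folklore] -/
theorem div_natCard_zpowers_sup_pos (hZ : Z ≤ Subgroup.center G) [Finite G] (g : G) :
    0 < Nat.card (Subgroup.normalizer (g • (Z : Set G))) /
        Nat.card (Subgroup.zpowers g ⊔ Z : Subgroup G) :=
  Nat.div_pos (Nat.card_le_card_of_injective _
    (Subgroup.inclusion_injective (zpowers_sup_le_setNormalizer_smul hZ g))) Nat.card_pos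

/-- The fixed-point hypothesis of `ChebotarevNaturalUpperBoundProofs` for the orbit of `g Z`
with `H = ⟨g⟩Z` and `k = k_g`. [folklore] -/
theorem div_mul_natCard_le_natCard_conj_mem (hZ : Z ≤ Subgroup.center G) [Finite G] {g x : G}
    (hx : ∃ y : G, ∃ z ∈ Z, x = y * (g * z) * y⁻¹) :
    Nat.card (Subgroup.normalizer (g • (Z : Set G))) /
        Nat.card (Subgroup.zpowers g ⊔ Z : Subgroup G) *
      Nat.card (Subgroup.zpowers g ⊔ Z : Subgroup G) ≤
      Nat.card {y : G // y⁻¹ * x * y ∈ Subgroup.zpowers g ⊔ Z} := by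
  rw [div_mul_natCard_zpowers_sup hZ]
  exact natCard_setNormalizer_le_natCard_conj_mem hZ hx

/-- **`1/k_g ≤ 2 #O_g / #G`** for `g² ∈ Z`: the upper-density bound of the orbit `O_g` of `g Z`
is at most twice its share `#O_g/#G`. [folklore] -/
theorem one_div_le_two_mul_natCard_orbit_div (hZ : Z ≤ Subgroup.center G) [Finite G] {g : G}
    (hg : g ^ 2 ∈ Z) :
    (1 : ℝ) / (Nat.card (Subgroup.normalizer (g • (Z : Set G))) /
        Nat.card (Subgroup.zpowers g ⊔ Z : Subgroup G) : ℕ) ≤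
      2 * Nat.card {x : G // ∃ y : G, ∃ z ∈ Z, x = y * (g * z) * y⁻¹} / Nat.card G := by
  set k := Nat.card (Subgroup.normalizer (g • (Z : Set G))) /
        Nat.card (Subgroup.zpowers g ⊔ Z : Subgroup G) with hk
  have hkH := div_mul_natCard_zpowers_sup hZ g
  have h1 := natCard_mul_natCard_le_natCard_orbit_mul hZ g
  have h2 := natCard_zpowers_sup_le hZ hg
  have hH : 0 < Nat.card (Subgroup.zpowers g ⊔ Z : Subgroup G) := Nat.card_pos
  -- `#G · #H ≤ 2 #O · k · #H`
  have h3 : Nat.card G * Nat.card (Subgroup.zpowers g ⊔ Z : Subgroup G) ≤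
      2 * Nat.card {x : G // ∃ y : G, ∃ z ∈ Z, x = y * (g * z) * y⁻¹} * k *
        Nat.card (Subgroup.zpowers g ⊔ Z : Subgroup G) := by
    rw [← hk] at hkH
    calc Nat.card G * Nat.card (Subgroup.zpowers g ⊔ Z : Subgroup G)
        ≤ Nat.card G * (2 * Nat.card Z) := Nat.mul_le_mul_left _ h2
      _ = 2 * (Nat.card G * Nat.card Z) := by ring
      _ ≤ 2 * (Nat.card {x : G // ∃ y : G, ∃ z ∈ Z, x = y * (g * z) * y⁻¹} *
            Nat.card (Subgroup.normalizer (g • (Z : Set G)))) := Nat.mul_le_mul_left _ h1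
      _ = _ := by rw [← hkH]; ring
  have h4 : Nat.card G ≤ 2 * Nat.card {x : G // ∃ y : G, ∃ z ∈ Z, x = y * (g * z) * y⁻¹} * k :=
    Nat.le_of_mul_le_mul_right h3 hH
  have hkpos : 0 < k := div_natCard_zpowers_sup_pos hZ g
  have hG : (0 : ℝ) < Nat.card G := by exact_mod_cast (Nat.card_pos (α := G))
  rw [div_le_div_iff₀ (by exact_mod_cast hkpos) hG, one_mul]
  exact_mod_cast h4

/-- The fixed-point hypothesis for the centre part `C = Z`, `H = Z`, `k = [G : Z]`: every `y`
conjugates a central element into `Z`. [folklore] -/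
theorem index_mul_natCard_le_natCard_conj_mem (hZ : Z ≤ Subgroup.center G) [Finite G] {x : G}
    (hx : x ∈ Z) : Z.index * Nat.card Z ≤ Nat.card {y : G // y⁻¹ * x * y ∈ Z} := by
  rw [mul_comm, Subgroup.card_mul_index]
  refine (Nat.card_congr (Equiv.subtypeUnivEquiv fun y ↦ ?_)).symm.le
  have : y⁻¹ * x * y = x := by
    rw [mul_assoc, ← mul_eq_mul_of_le_center hZ hx y, ← mul_assoc, inv_mul_cancel, one_mul]
  rw [this]
  exact hx

/-- `1/[G : Z] = #Z/#G`. [folklore] -/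
theorem one_div_index_eq [Finite G] (Z : Subgroup G) :
    (1 : ℝ) / Z.index = Nat.card Z / Nat.card G := by
  have h := Z.card_mul_index
  have hG : (0 : ℝ) < Nat.card G := by exact_mod_cast (Nat.card_pos (α := G))
  have hZ : (0 : ℝ) < Nat.card Z := by exact_mod_cast (Nat.card_pos (α := Z))
  have hi : (0 : ℝ) < Z.index := by exact_mod_cast Nat.pos_of_ne_zero Z.index_ne_zero_of_finite
  rw [div_eq_div_iff hi.ne' hG.ne', one_mul, ← Nat.cast_mul, h]

/-! #### The orbits `O_g = {y g z y⁻¹}` partition `{x : x² ∈ Z} ∖ Z` -/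

/-- `g ∈ O_g`. [folklore] -/
theorem mem_orbit_self (g : G) : ∃ y : G, ∃ z ∈ Z, g = y * (g * z) * y⁻¹ :=
  ⟨1, 1, Z.one_mem, by group⟩

/-- Transitivity: `x ∈ O_g`, `w ∈ O_x` give `w ∈ O_g`. [folklore] -/
theorem mem_orbit_trans (hZ : Z ≤ Subgroup.center G) {g x w : G}
    (hx : ∃ y : G, ∃ z ∈ Z, x = y * (g * z) * y⁻¹) (hw : ∃ y : G, ∃ z ∈ Z, w = y * (x * z) * y⁻¹) :
    ∃ y : G, ∃ z ∈ Z, w = y * (g * z) * y⁻¹ := by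
  obtain ⟨y, z, hz, rfl⟩ := hx
  obtain ⟨y', z', hz', rfl⟩ := hw
  refine ⟨y' * y, z * z', Z.mul_mem hz hz', ?_⟩
  calc y' * (y * (g * z) * y⁻¹ * z') * y'⁻¹ = y' * (y * (g * z) * (y⁻¹ * z')) * y'⁻¹ := by group
    _ = y' * (y * (g * z) * (z' * y⁻¹)) * y'⁻¹ := by rw [mul_eq_mul_of_le_center hZ hz' y⁻¹]
    _ = y' * y * (g * (z * z')) * (y' * y)⁻¹ := by group

/-- Symmetry: `x ∈ O_g` gives `g ∈ O_x`. [folklore] -/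
theorem mem_orbit_symm (hZ : Z ≤ Subgroup.center G) {g x : G}
    (hx : ∃ y : G, ∃ z ∈ Z, x = y * (g * z) * y⁻¹) : ∃ y : G, ∃ z ∈ Z, g = y * (x * z) * y⁻¹ := by
  obtain ⟨y, z, hz, rfl⟩ := hx
  refine ⟨y⁻¹, z⁻¹, Z.inv_mem hz, ?_⟩
  calc g = y⁻¹ * (y * (g * z) * y⁻¹) * y * z⁻¹ := by group
    _ = y⁻¹ * (y * (g * z) * y⁻¹) * (z⁻¹ * y) := by
        rw [mul_assoc, mul_eq_mul_of_le_center hZ (Z.inv_mem hz) y]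
    _ = y⁻¹ * (y * (g * z) * y⁻¹ * z⁻¹) * y⁻¹⁻¹ := by group

/-- The orbit relation is an equivalence: `x ∈ O_g` gives `O_x = O_g`. [folklore] -/
theorem orbit_eq_of_mem (hZ : Z ≤ Subgroup.center G) {g x : G}
    (hx : ∃ y : G, ∃ z ∈ Z, x = y * (g * z) * y⁻¹) (w : G) :
    (∃ y : G, ∃ z ∈ Z, w = y * (x * z) * y⁻¹) ↔ ∃ y : G, ∃ z ∈ Z, w = y * (g * z) * y⁻¹ :=
  ⟨mem_orbit_trans hZ hx, mem_orbit_trans hZ (mem_orbit_symm hZ hx)⟩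

/-- The orbits are conjugation-stable. [folklore] -/
theorem conj_mem_orbit (hZ : Z ≤ Subgroup.center G) {g x : G} (a : G)
    (hx : ∃ y : G, ∃ z ∈ Z, x = y * (g * z) * y⁻¹) :
    ∃ y : G, ∃ z ∈ Z, a * x * a⁻¹ = y * (g * z) * y⁻¹ :=
  mem_orbit_trans hZ hx ⟨a, 1, Z.one_mem, by rw [mul_one]⟩

/-- For `g² ∈ Z` the orbit `O_g` consists of elements with square in `Z`. [folklore] -/
theorem sq_mem_of_mem_orbit (hZ : Z ≤ Subgroup.center G) {g x : G} (hg : g ^ 2 ∈ Z)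
    (hx : ∃ y : G, ∃ z ∈ Z, x = y * (g * z) * y⁻¹) : x ^ 2 ∈ Z := by
  haveI := normal_of_le_center hZ
  obtain ⟨y, z, hz, rfl⟩ := hx
  have : (y * (g * z) * y⁻¹) ^ 2 = y * (g ^ 2 * (z * z)) * y⁻¹ := by
    calc (y * (g * z) * y⁻¹) ^ 2 = y * (g * (z * g) * z) * y⁻¹ := by
          rw [sq]; group
      _ = y * (g * (g * z) * z) * y⁻¹ := by rw [mul_eq_mul_of_le_center hZ hz g]
      _ = y * (g ^ 2 * (z * z)) * y⁻¹ := by rw [sq]; group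
  rw [this]
  exact Subgroup.Normal.conj_mem inferInstance _ (Z.mul_mem hg (Z.mul_mem hz hz)) y

/-- For `g ∉ Z` the orbit `O_g` avoids `Z`. [folklore] -/
theorem not_mem_of_mem_orbit (hZ : Z ≤ Subgroup.center G) {g x : G} (hg : g ∉ Z)
    (hx : ∃ y : G, ∃ z ∈ Z, x = y * (g * z) * y⁻¹) : x ∉ Z := by
  intro hxZ
  obtain ⟨y, z, hz, hgx⟩ := mem_orbit_symm hZ hx
  haveI := normal_of_le_center hZ
  rw [hgx] at hg
  exact hg (Subgroup.Normal.conj_mem inferInstance _ (Z.mul_mem hxZ hz) y)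

/-- `Z ⊆ {x : x² ∈ Z}`. [folklore] -/
theorem sq_mem_of_mem {x : G} (hx : x ∈ Z) : x ^ 2 ∈ Z := Z.pow_mem hx 2

/-- **Orbit decomposition of `{x : x² ∈ Z} ∖ Z`.**  For a central subgroup `Z` of a finite group
`G` there is a finite family `𝒪` of orbits `O_a = {y a z y⁻¹ : y ∈ G, z ∈ Z}` (`a² ∈ Z`,
`a ∉ Z`) covering `{x : x² ∈ Z} ∖ Z` with `Σ_{O ∈ 𝒪} #O + #Z ≤ #{x : x² ∈ Z}` (in fact the
`O ∈ 𝒪` partition `{x : x² ∈ Z} ∖ Z`). [folklore] -/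
theorem exists_finset_orbits_sq_mem [Finite G] (hZ : Z ≤ Subgroup.center G) :
    ∃ 𝒪 : Finset (Finset G),
      (∀ A ∈ 𝒪, ∃ a : G, a ^ 2 ∈ Z ∧ a ∉ Z ∧
        ∀ x : G, x ∈ A ↔ ∃ y : G, ∃ z ∈ Z, x = y * (a * z) * y⁻¹) ∧
      (∀ x : G, x ^ 2 ∈ Z → x ∉ Z → ∃ A ∈ 𝒪, x ∈ A) ∧
      (∑ A ∈ 𝒪, A.card) + Nat.card Z ≤ Nat.card {x : G // x ^ 2 ∈ Z} := by
  classical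
  haveI := Fintype.ofFinite G
  -- the orbit of `a` as a finset, and the family of orbits of the elements of `T ∖ Z`
  set orb : G → Finset G := fun a ↦
    Finset.univ.filter fun x ↦ ∃ y : G, ∃ z ∈ Z, x = y * (a * z) * y⁻¹ with horb
  have mem_orb : ∀ a x : G, x ∈ orb a ↔ ∃ y : G, ∃ z ∈ Z, x = y * (a * z) * y⁻¹ := fun a x ↦ by
    rw [horb, Finset.mem_filter]
    exact ⟨fun h ↦ h.2, fun h ↦ ⟨Finset.mem_univ _, h⟩⟩
  set TZ : Finset G := Finset.univ.filter fun a ↦ a ^ 2 ∈ Z ∧ a ∉ Z with hTZ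
  refine ⟨TZ.image orb, fun A hA ↦ ?_, fun x hx hxZ ↦ ?_, ?_⟩
  · obtain ⟨a, ha, rfl⟩ := Finset.mem_image.mp hA
    rw [hTZ, Finset.mem_filter] at ha
    exact ⟨a, ha.2.1, ha.2.2, mem_orb a⟩
  · refine ⟨orb x, Finset.mem_image.mpr ⟨x, ?_, rfl⟩, (mem_orb x x).mpr (mem_orbit_self x)⟩
    rw [hTZ, Finset.mem_filter]
    exact ⟨Finset.mem_univ _, hx, hxZ⟩
  · -- the orbits in the family are pairwise disjoint and contained in `T ∖ Z`
    have hdisj : ((TZ.image orb : Finset (Finset G)) : Set (Finset G)).PairwiseDisjoint id := by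
      intro A hA B hB hAB
      obtain ⟨a, -, rfl⟩ := Finset.mem_image.mp hA
      obtain ⟨b, -, rfl⟩ := Finset.mem_image.mp hB
      rw [Function.onFun, Finset.disjoint_left]
      intro x hxa hxb
      apply hAB
      ext w
      rw [mem_orb, mem_orb, ← orbit_eq_of_mem hZ ((mem_orb a x).mp hxa) w,
        orbit_eq_of_mem hZ ((mem_orb b x).mp hxb) w]
    have hunion : (TZ.image orb).biUnion id ⊆ TZ := by
      intro x hx
      obtain ⟨A, hA, hxA⟩ := Finset.mem_biUnion.mp hx
      obtain ⟨a, ha, rfl⟩ := Finset.mem_image.mp hA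
      rw [hTZ, Finset.mem_filter] at ha ⊢
      have hxa := (mem_orb a x).mp hxA
      exact ⟨Finset.mem_univ _, sq_mem_of_mem_orbit hZ ha.2.1 hxa, not_mem_of_mem_orbit hZ ha.2.2 hxa⟩
    have hsum : ∑ A ∈ TZ.image orb, A.card = ((TZ.image orb).biUnion id).card := by
      rw [Finset.card_biUnion hdisj]
      rfl
    -- `#TZ + #Z = #{x : x² ∈ Z}`
    set T : Finset G := Finset.univ.filter fun a ↦ a ^ 2 ∈ Z with hT
    set ZF : Finset G := Finset.univ.filter fun a ↦ a ∈ Z with hZF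
    have hTZeq : TZ = T \ ZF := by
      ext a
      simp only [hTZ, hT, hZF, Finset.mem_filter, Finset.mem_univ, true_and, Finset.mem_sdiff]
    have hZFT : ZF ⊆ T := by
      intro a ha
      rw [hZF, Finset.mem_filter] at ha
      rw [hT, Finset.mem_filter]
      exact ⟨ha.1, sq_mem_of_mem ha.2⟩
    have hcardT : T.card = Nat.card {x : G // x ^ 2 ∈ Z} := by
      rw [Nat.card_eq_fintype_card, Fintype.card_subtype]
    have hcardZ : ZF.card = Nat.card Z := by
      rw [hZF, Nat.card_eq_fintype_card, ← Fintype.card_subtype]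
    rw [hsum, ← hcardT, ← hcardZ, ← Finset.card_sdiff_add_card_eq_card hZFT, ← hTZeq]
    exact Nat.add_le_add_right (Finset.card_le_card hunion) _

/-! ### The contraction lemma -/

/-- A subgroup with more than half the elements is everything. [folklore] -/
theorem eq_top_of_card_lt_two_mul {K : Type*} [Group K] [Finite K] (D : Subgroup K)
    (h : Nat.card K < 2 * Nat.card D) : D = ⊤ := by
  by_contra hD
  have h1 := Subgroup.one_lt_index_of_ne_top hD
  have h2 := D.card_mul_index
  have : 2 * Nat.card D ≤ Nat.card D * D.index := by
    rw [mul_comm]; exact Nat.mul_le_mul_left _ h1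
  omega

/-- For `g² ∈ Z` (central): `(g u)² ∈ Z ↔ (g⁻¹ u g) u ∈ Z`. [folklore] -/
theorem sq_mul_mem_iff {g : G} (hg : g ^ 2 ∈ Z) (u : G) :
    (g * u) ^ 2 ∈ Z ↔ g⁻¹ * u * g * u ∈ Z := by
  have : (g * u) ^ 2 = g ^ 2 * (g⁻¹ * u * g * u) := by rw [sq, sq]; group
  rw [this, Subgroup.mul_mem_cancel_left Z hg]

/-- **The commutator identity.**  If `g² ∈ Z` and `(g u)², (g v)², (g u v)² ∈ Z` (`Z` central)
then `u⁻¹ v⁻¹ u v ∈ Z`: writing `c_w = (g⁻¹ w g) w ∈ Z`, one has `c_{uv} = c_u c_v · u⁻¹v⁻¹uv`.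
[folklore] -/
theorem commutator_mem_of_sq_mul_mem (hZ : Z ≤ Subgroup.center G) {g u v : G} (hg : g ^ 2 ∈ Z)
    (hu : (g * u) ^ 2 ∈ Z) (hv : (g * v) ^ 2 ∈ Z) (huv : (g * (u * v)) ^ 2 ∈ Z) :
    u⁻¹ * v⁻¹ * u * v ∈ Z := by
  rw [sq_mul_mem_iff hg] at hu hv huv
  set cu := g⁻¹ * u * g * u with hcu
  set cv := g⁻¹ * v * g * v with hcv
  have h1 : g⁻¹ * u * g = cu * u⁻¹ := by rw [hcu]; group
  have h2 : g⁻¹ * v * g = cv * v⁻¹ := by rw [hcv]; group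
  have key : g⁻¹ * (u * v) * g * (u * v) = cu * cv * (u⁻¹ * v⁻¹ * u * v) := by
    calc g⁻¹ * (u * v) * g * (u * v) = (g⁻¹ * u * g) * (g⁻¹ * v * g) * u * v := by group
      _ = (cu * u⁻¹) * (cv * v⁻¹) * u * v := by rw [h1, h2]
      _ = cu * (u⁻¹ * cv) * v⁻¹ * u * v := by group
      _ = cu * (cv * u⁻¹) * v⁻¹ * u * v := by rw [mul_eq_mul_of_le_center hZ hv u⁻¹]
      _ = cu * cv * (u⁻¹ * v⁻¹ * u * v) := by group
  rw [key, Subgroup.mul_mem_cancel_left Z (Z.mul_mem hu hv)] at huv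
  exact huv

/-- **Contraction lemma, based form.**  Let `Z` be a central subgroup and `K` a normal subgroup
of a finite group `G` such that some commutator of two elements of `K` lies outside `Z`, and let
`g² ∈ Z`.  Then at most three quarters of the `u ∈ K` have `(g u)² ∈ Z`:
`4 · #{u ∈ K : (g u)² ∈ Z} ≤ 3 · #K`.  (If more did, the commutator identity
`commutator_mem_of_sq_mul_mem` would make, for each such `u`, the subgroup
`{v : u⁻¹v⁻¹uv ∈ Z}` contain more than half of `K`, hence all of `K`; and then for each `v ∈ K`
the subgroup `{u : u⁻¹v⁻¹uv ∈ Z}` would contain more than half of `K`, hence all of `K`.)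
[folklore] -/
theorem four_mul_natCard_sq_mem_le_of_sq_mem [Finite G] (hZ : Z ≤ Subgroup.center G)
    (K : Subgroup G) [K.Normal] (hK : ∃ u ∈ K, ∃ v ∈ K, u⁻¹ * v⁻¹ * u * v ∉ Z) {g : G}
    (hg : g ^ 2 ∈ Z) :
    4 * Nat.card {u : K // (g * u) ^ 2 ∈ Z} ≤ 3 * Nat.card K := by
  classical
  haveI := Fintype.ofFinite G
  haveI : Z.Normal := normal_of_le_center hZ
  by_contra hlt
  push Not at hlt
  -- commutators in `Z` = commuting images in `G/Z`
  set π := QuotientGroup.mk' Z with hπ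
  have hcomm : ∀ a b : G, a⁻¹ * b⁻¹ * a * b ∈ Z ↔ π b * π a = π a * π b := by
    intro a b
    rw [← map_mul, ← map_mul, hπ, QuotientGroup.mk'_apply, QuotientGroup.mk'_apply,
      QuotientGroup.eq, mul_inv_rev, ← mul_assoc]
  -- the finset `A = {u : (g u)² ∈ Z}` of `K`
  set A : Finset K := Finset.univ.filter fun u ↦ (g * u) ^ 2 ∈ Z with hA
  have hAcard : A.card = Nat.card {u : K // (g * u) ^ 2 ∈ Z} := by
    rw [Nat.card_eq_fintype_card, Fintype.card_subtype]
  have hKcard : (Finset.univ : Finset K).card = Nat.card K := by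
    rw [Nat.card_eq_fintype_card, Finset.card_univ]
  -- Step A: for `u ∈ A`, every `v ∈ K` has `u⁻¹v⁻¹uv ∈ Z`
  have hstepA : ∀ u : K, (g * u) ^ 2 ∈ Z → ∀ v : K, (u : G)⁻¹ * (v : G)⁻¹ * u * v ∈ Z := by
    intro u hu
    set D : Subgroup K := ((Subgroup.centralizer {π u}).comap π).subgroupOf K with hD
    have hmemD : ∀ v : K, v ∈ D ↔ (u : G)⁻¹ * (v : G)⁻¹ * u * v ∈ Z := by
      intro v
      rw [hD, Subgroup.mem_subgroupOf, Subgroup.mem_comap, Subgroup.mem_centralizer_singleton_iff,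
        hcomm]
    -- `A ∩ u⁻¹A ⊆ D` and `#(A ∩ u⁻¹A) ≥ 2 #A - #K > #K / 2`
    set B : Finset K := Finset.univ.filter fun v ↦ (g * (u * v)) ^ 2 ∈ Z with hB
    have hBcard : B.card = A.card := by
      refine Finset.card_bij (fun v _ ↦ u * v) (fun v hv ↦ ?_) (fun v₁ _ v₂ _ h ↦ mul_left_cancel h)
        (fun w hw ↦ ⟨u⁻¹ * w, ?_, by rw [mul_inv_cancel_left]⟩)
      · rw [hB, Finset.mem_filter] at hv
        rw [hA, Finset.mem_filter, Subgroup.coe_mul]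
        exact ⟨Finset.mem_univ _, hv.2⟩
      · rw [hA, Finset.mem_filter] at hw
        rw [hB, Finset.mem_filter, Subgroup.coe_mul, Subgroup.coe_inv, mul_inv_cancel_left]
        exact ⟨Finset.mem_univ _, hw.2⟩
    have hsub : A ∩ B ⊆ Finset.univ.filter fun v ↦ v ∈ D := by
      intro v hv
      rw [Finset.mem_inter, hA, hB, Finset.mem_filter, Finset.mem_filter] at hv
      rw [Finset.mem_filter, hmemD]
      exact ⟨Finset.mem_univ _, commutator_mem_of_sq_mul_mem hZ hg hu hv.1.2 hv.2.2⟩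
    have hDcard : (Finset.univ.filter fun v ↦ v ∈ D).card = Nat.card D := by
      rw [Nat.card_eq_fintype_card, ← Fintype.card_subtype]
    have hie := Finset.card_union_add_card_inter A B
    have hunion : (A ∪ B).card ≤ (Finset.univ : Finset K).card := Finset.card_le_univ _
    have hinter := Finset.card_le_card hsub
    have hDtop : D = ⊤ := eq_top_of_card_lt_two_mul D (by omega)
    intro v
    exact (hmemD v).mp (hDtop ▸ Subgroup.mem_top v)
  -- Step B: for every `v ∈ K`, the subgroup `{u : v, u commute mod Z}` contains `A`, hence is `K`
  have hstepB : ∀ v u : K, (u : G)⁻¹ * (v : G)⁻¹ * u * v ∈ Z := by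
    intro v
    set D' : Subgroup K := ((Subgroup.centralizer {π v}).comap π).subgroupOf K with hD'
    have hmemD' : ∀ u : K, u ∈ D' ↔ (u : G)⁻¹ * (v : G)⁻¹ * u * v ∈ Z := by
      intro u
      rw [hD', Subgroup.mem_subgroupOf, Subgroup.mem_comap, Subgroup.mem_centralizer_singleton_iff,
        hcomm]
      exact ⟨fun h ↦ h.symm, fun h ↦ h.symm⟩
    have hsub : A ⊆ Finset.univ.filter fun u ↦ u ∈ D' := by
      intro u hu
      rw [hA, Finset.mem_filter] at hu
      rw [Finset.mem_filter, hmemD']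
      exact ⟨Finset.mem_univ _, hstepA u hu.2 v⟩
    have hD'card : (Finset.univ.filter fun u ↦ u ∈ D').card = Nat.card D' := by
      rw [Nat.card_eq_fintype_card, ← Fintype.card_subtype]
    have hinter := Finset.card_le_card hsub
    have hD'top : D' = ⊤ := eq_top_of_card_lt_two_mul D' (by omega)
    intro u
    exact (hmemD' u).mp (hD'top ▸ Subgroup.mem_top u)
  obtain ⟨u, hu, v, hv, huv⟩ := hK
  exact huv (hstepB ⟨v, hv⟩ ⟨u, hu⟩)

/-- **Contraction lemma** (finite groups).  Let `Z` be a central subgroup and `K` a normal subgroup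
of a finite group `G` such that some commutator of two elements of `K` lies outside `Z`.  Then in
every coset `g₀ K` at most three quarters of the elements have their square in `Z`:
`4 · #{u ∈ K : (g₀ u)² ∈ Z} ≤ 3 · #K` (`four_mul_natCard_sq_mem_le_of_sq_mem` at a base point
`g = g₀ u₀` of the coset with `g² ∈ Z`, if there is one). [folklore] -/
theorem four_mul_natCard_sq_mem_le [Finite G] (hZ : Z ≤ Subgroup.center G) (K : Subgroup G)
    [K.Normal] (hK : ∃ u ∈ K, ∃ v ∈ K, u⁻¹ * v⁻¹ * u * v ∉ Z) (g₀ : G) :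
    4 * Nat.card {u : K // (g₀ * u) ^ 2 ∈ Z} ≤ 3 * Nat.card K := by
  rcases Nat.eq_zero_or_pos (Nat.card {u : K // (g₀ * u) ^ 2 ∈ Z}) with h0 | hpos
  · rw [h0, mul_zero]
    exact Nat.zero_le _
  obtain ⟨⟨u₀, hu₀⟩, -⟩ := Nat.card_ne_zero.mp hpos.ne'
  have hcard : Nat.card {u : K // (g₀ * u₀ * u) ^ 2 ∈ Z} =
      Nat.card {u : K // (g₀ * u) ^ 2 ∈ Z} := by
    refine Nat.card_congr (Equiv.subtypeEquiv (Equiv.mulLeft u₀) fun u ↦ ?_)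
    simp only [Equiv.coe_mulLeft, Subgroup.coe_mul, mul_assoc]
  rw [← hcard]
  exact four_mul_natCard_sq_mem_le_of_sq_mem hZ K hK hu₀

/-- **Contraction of the square-central ratio along a quotient.**  Let `π : G ↠ Q` be a surjection
of finite groups with kernel `K`, `Z ≤ G` and `Z_Q ≤ Q` central subgroups with `π(Z) ≤ Z_Q`, and
suppose some commutator of elements of `K` lies outside `Z`.  Then
`#{g ∈ G : g² ∈ Z} / #G ≤ (3/4) · #{q ∈ Q : q² ∈ Z_Q} / #Q`. [folklore] -/
theorem natCard_sq_mem_div_le_of_commutator_not_mem [Finite G] {Q : Type*} [Group Q] [Finite Q]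
    (hZ : Z ≤ Subgroup.center G) (ZQ : Subgroup Q) (π : G →* Q) (hπ : Function.Surjective π)
    (hZQ : Z.map π ≤ ZQ) (hK : ∃ u ∈ π.ker, ∃ v ∈ π.ker, u⁻¹ * v⁻¹ * u * v ∉ Z) :
    (Nat.card {g : G // g ^ 2 ∈ Z} : ℝ) / Nat.card G ≤
      3 / 4 * (Nat.card {q : Q // q ^ 2 ∈ ZQ} / Nat.card Q) := by
  classical
  haveI := Fintype.ofFinite G
  haveI := Fintype.ofFinite Q
  -- fibrewise count: `#{g : g² ∈ Z} = Σ_q #{g : g² ∈ Z, π g = q}`, nonzero only for `q² ∈ Z_Q`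
  set T : Finset G := Finset.univ.filter fun g ↦ g ^ 2 ∈ Z with hT
  set TQ : Finset Q := Finset.univ.filter fun q ↦ q ^ 2 ∈ ZQ with hTQ
  have hTcard : T.card = Nat.card {g : G // g ^ 2 ∈ Z} := by
    rw [Nat.card_eq_fintype_card, Fintype.card_subtype]
  have hTQcard : TQ.card = Nat.card {q : Q // q ^ 2 ∈ ZQ} := by
    rw [Nat.card_eq_fintype_card, Fintype.card_subtype]
  have hmaps : ∀ g ∈ T, π g ∈ TQ := by
    intro g hg
    rw [hT, Finset.mem_filter] at hg
    rw [hTQ, Finset.mem_filter, ← map_pow]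
    exact ⟨Finset.mem_univ _, hZQ (Subgroup.mem_map_of_mem π hg.2)⟩
  -- each fibre has at most `(3/4) #K` elements
  have hfibre : ∀ q ∈ TQ, 4 * (T.filter fun g ↦ π g = q).card ≤ 3 * Nat.card π.ker := by
    intro q _
    obtain ⟨g₀, rfl⟩ := hπ q
    have h := four_mul_natCard_sq_mem_le hZ π.ker hK g₀
    -- `{g ∈ T : π g = π g₀} = g₀ · {u ∈ K : (g₀ u)² ∈ Z}`
    have hc : (T.filter fun g ↦ π g = π g₀) =
        (Finset.univ.filter fun u : π.ker ↦ (g₀ * (u : G)) ^ 2 ∈ Z).map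
          ⟨fun u : π.ker ↦ g₀ * (u : G), fun a b hab ↦ Subtype.ext (mul_left_cancel hab)⟩ := by
      ext x
      simp only [Finset.mem_filter, Finset.mem_map, Finset.mem_univ, true_and,
        Function.Embedding.coeFn_mk, hT]
      constructor
      · rintro ⟨hx, hπx⟩
        refine ⟨⟨g₀⁻¹ * x, ?_⟩, ?_, ?_⟩
        · rw [MonoidHom.mem_ker, map_mul, map_inv, hπx, inv_mul_cancel]
        · show (g₀ * (g₀⁻¹ * x)) ^ 2 ∈ Z
          rw [mul_inv_cancel_left]
          exact hx
        · exact mul_inv_cancel_left g₀ x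
      · rintro ⟨u, hu, rfl⟩
        refine ⟨hu, ?_⟩
        rw [map_mul, (MonoidHom.mem_ker).mp u.2, mul_one]
    have hc' : (T.filter fun g ↦ π g = π g₀).card = Nat.card {u : π.ker // (g₀ * u) ^ 2 ∈ Z} := by
      rw [hc, Finset.card_map, Nat.card_eq_fintype_card, Fintype.card_subtype]
    rw [hc']
    exact h
  -- sum over the fibres
  have hsum : T.card = ∑ q ∈ TQ, (T.filter fun g ↦ π g = q).card :=
    Finset.card_eq_sum_card_fiberwise hmaps
  have hbound : 4 * T.card ≤ 3 * Nat.card π.ker * TQ.card := by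
    rw [hsum, Finset.mul_sum, mul_comm (3 * Nat.card π.ker), Finset.card_eq_sum_ones TQ,
      Finset.sum_mul, one_mul]
    exact Finset.sum_le_sum hfibre
  -- `#G = #K · #Q`
  have hGKQ : Nat.card G = Nat.card π.ker * Nat.card Q := by
    rw [← π.ker.card_mul_index, Subgroup.index_ker, MonoidHom.range_eq_top.mpr hπ,
      Subgroup.card_top]
  have hG : (0 : ℝ) < Nat.card G := by exact_mod_cast (Nat.card_pos (α := G))
  have hQ : (0 : ℝ) < Nat.card Q := by exact_mod_cast (Nat.card_pos (α := Q))
  have hKpos : (0 : ℝ) < Nat.card π.ker := by exact_mod_cast (Nat.card_pos (α := π.ker))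
  rw [← hTcard, ← hTQcard, div_le_iff₀ hG, hGKQ]
  have hb : (4 : ℝ) * T.card ≤ 3 * Nat.card π.ker * TQ.card := by exact_mod_cast hbound
  push_cast
  rw [show (3 : ℝ) / 4 * (TQ.card / Nat.card Q) * (Nat.card π.ker * Nat.card Q) =
      3 * Nat.card π.ker * TQ.card / 4 by field_simp]
  linarith

end Literature.GroupTheory.SquareCentral
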